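import Summits.HodgeConjecture.CorCM.Census.CentralSquaresPairFaceM2

/-!
# The square-central class, XX: TWO SWAPS at `m = 2` — all `Y_s` congruent, all `Y'_a` congruent, and the residual closure from one sum of each kind

COR-CM (cell `pub-hodgecm2`), count-neutral kernel combinatorics by the binder seat b09 (gen 46; lane SQUARE-CENTRAL CLASS, part XX), on parts II
(`residual_closure_four`), VI (`rel_transversal_mem`), VII (`Y_sub_Y_mem`, `relc_mem`, `pair_stable`, `companion_*`), VIII (`ne_rep`), XVIII (`sdiff_compl_eq_inter`)
BY NAME.  Theorems only: no definition, no `decide`, no certificate, no named fact, no `sorry`.  HONEST FRAMING: `HC_CM` is NOT proved, here or anywhere in the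
tree; nothing here is a period or a headline.

THE FRAME `(T₀; T₁, Q)` at `m = 2` (notation of parts XVIII/XIX) WITH A SECOND SWAP `Q₂`: `T₀·Q₂⁻¹ = T₁`, `Q₂² = 1`, its place involution `σ₂` preserves `𝓗` and
differs from `σ` at EVERY place (`hne`).  In the degree-16 dihedral rows (part XXI) `Q₂ = zQ` for the kernel involution `z`.  On the four places of `𝓗` (and of
`T₀ ∩ T₁`) two fixed-point-free involutions that differ everywhere have the property that the `σ`-PAIRS are exactly the `σ₂`-TRANSVERSALS:

* §1 `transversal_pair`, `transversal_pair_inter`: `{s, σs}` (`s ∈ 𝓗`) is a `σ₂`-transversal of `𝓗`; `{a, σa}` (`a ∈ T₀ ∩ T₁`) one of `T₀ ∩ T₁` (companion frame).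
  Hence parts VI/VII for `Q₂` give `R({s, σs})`, `Rᶜ({a, σa})`, `Y_s − Y_{σ₂ s}`, `Y'_a − Y'_{σ₂ a}` in `L` with no further transversal hypothesis.
* §2 `Y_sub_Y_mem_of_swaps`: **all `Y_s` (`s ∈ 𝓗`) are congruent modulo `L`** — `𝓗 = {s, σs, σ₂s, σσ₂s}` is one orbit of `⟨σ, σ₂⟩`;
  `two_smul_Y_mem_of_swaps`: one sum `Y_{s₀} + Y_{s₁} ∈ L` then gives `2Y_s ∈ L` for every `s ∈ 𝓗`.
* §3 `two_smul_Y'_mem_of_swaps`: the same for `Y'_a` (`a ∈ T₀ ∩ T₁`), by §2 in the companion frame `(T₀; T̄₁, cQ, cQ₂)`.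
* §4 **`residual_closure_frame_two`** (`m = 2`): a strict lowering cover feeding `L ∋ pairs`, the two swaps, ONE sum `Y_{s₀} + Y_{s₁} ∈ L` and ONE sum
  `Y'_{a₀} + Y'_{a₁} ∈ L` (part XIX: from the designated pair face and its companion) ⟹ every residual Hodge vector lies in `L` up to `2`
  (part IIʼs `residual_closure_four` with `R(T)`, `Rᶜ(T')` from parts VI/VII).

## References
* [Pohlmann1968] H. Pohlmann, Algebraic cycles on abelian varieties of complex multiplication type, Ann. of Math. 88 (1968), Thm 1.
* [Milne1999] J. S. Milne, Lefschetz motives and the Tate conjecture, Compositio Math. 117 (1999), Prop. 2.1, p. 54.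
-/

namespace Summit.HodgeConjecture.CorCM.Census.CentralSquares

open Finset
open scoped symmDiff
open Summit.HodgeConjecture.CorCM.Prior.AllgGroup.RfwfAllgGroup
open Summit.HodgeConjecture.CorCM.Census.BlockParity
open Summit.HodgeConjecture.CorCM.Census.Coinvariant
open Summit.HodgeConjecture.CorCM.Census.TwistGeneration
open Summit.HodgeConjecture.CorCM.Census.BaseBlock
open Summit.HodgeConjecture.CorCM.Census.CoverClosure

noncomputable section

variable {G : Type*} [Group G] [Fintype G] [DecidableEq G] (c : G)

section Frame

variable (hc2 : c * c = 1) (hcen : ∀ x : G, x * c = c * x) (T₀ T₁ : CMF G c)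
variable (hbase : ∀ Q : G, rt c Q T₀ = T₀ ∨ rt c Q T₀ = rt c c T₀ ∨ rt c Q T₀ = T₁ ∨ rt c Q T₀ = rt c c T₁)
variable (m : ℕ) (hn : T₀.1.card = 4 * m) (hH : (T₀.1 \ T₁.1).card = 2 * m)
variable (Q : G) (hQ : rt c Q T₀ = T₁) (hQQ : Q * Q = 1)
variable (hσH : ∀ t ∈ T₀.1, ∀ t' ∈ T₀.1, (t' = t * Q ∨ t' = c * (t * Q)) → (t ∈ T₀.1 \ T₁.1 ↔ t' ∈ T₀.1 \ T₁.1))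
variable (Q₂ : G) (hQ₂ : rt c Q₂ T₀ = T₁) (hQQ₂ : Q₂ * Q₂ = 1)
variable (hσH₂ : ∀ t ∈ T₀.1, ∀ t' ∈ T₀.1, (t' = t * Q₂ ∨ t' = c * (t * Q₂)) → (t ∈ T₀.1 \ T₁.1 ↔ t' ∈ T₀.1 \ T₁.1))
variable (hne : ∀ t ∈ T₀.1, ∀ t' ∈ T₀.1, ∀ t'' ∈ T₀.1, (t' = t * Q ∨ t' = c * (t * Q)) → (t'' = t * Q₂ ∨ t'' = c * (t * Q₂)) → t' ≠ t'')
variable (L : Submodule ℤ (CMF G c →₀ ℤ)) (hLrt : ∀ (Q' : G) (y : CMF G c →₀ ℤ), y ∈ L → Finsupp.mapDomain (rt c Q') y ∈ L)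
variable (hP : ∀ Ψ : CMF G c, pair c Ψ ∈ L)
variable (hcover : ∀ Ψ : CMF G c, 2 ≤ bpot c T₀ Ψ → ∃ Q₂ s s' : G, bpot c T₀ Ψ = ddist (rt c Q₂ T₀) Ψ ∧
    s ∈ (rt c Q₂ T₀).1 \ Ψ.1 ∧ s' ∈ (rt c Q₂ T₀).1 \ Ψ.1 ∧ s ≠ s' ∧
    gface c hc2 Ψ s s' ∈ L ∧
    ((∃ Q₁ t t' : G, bpot c T₀ Ψ = ddist (rt c Q₁ T₀) Ψ ∧ t ∈ (rt c Q₁ T₀).1 \ Ψ.1 ∧ t' ∈ (rt c Q₁ T₀).1 \ Ψ.1 ∧ t ≠ t' ∧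
        (∀ Q' : G, ddist (rt c Q' T₀) (oflipCM c hc2 t Ψ) = bpot c T₀ (oflipCM c hc2 t Ψ) → rt c Q' T₀ = rt c Q₁ T₀) ∧
        (∀ Q' : G, ddist (rt c Q' T₀) (oflipCM c hc2 t' Ψ) = bpot c T₀ (oflipCM c hc2 t' Ψ) → rt c Q' T₀ = rt c Q₁ T₀) ∧
        (∀ Q' : G, ddist (rt c Q' T₀) (oflipCM c hc2 t (oflipCM c hc2 t' Ψ)) = bpot c T₀ (oflipCM c hc2 t (oflipCM c hc2 t' Ψ)) →
          rt c Q' T₀ = rt c Q₁ T₀)) →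
      (∀ Q' : G, ddist (rt c Q' T₀) (oflipCM c hc2 s Ψ) = bpot c T₀ (oflipCM c hc2 s Ψ) → rt c Q' T₀ = rt c Q₂ T₀) ∧
      (∀ Q' : G, ddist (rt c Q' T₀) (oflipCM c hc2 s' Ψ) = bpot c T₀ (oflipCM c hc2 s' Ψ) → rt c Q' T₀ = rt c Q₂ T₀) ∧
      (∀ Q' : G, ddist (rt c Q' T₀) (oflipCM c hc2 s (oflipCM c hc2 s' Ψ)) = bpot c T₀ (oflipCM c hc2 s (oflipCM c hc2 s' Ψ)) →
        rt c Q' T₀ = rt c Q₂ T₀)))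

/-! ## §1 `σ`-pairs are `σ₂`-transversals -/

include hc2 hcen hn hH hQ hQQ hσH hQ₂ hσH₂ hne in
/-- **A swapped pair `{s, σs} ⊆ 𝓗` is a transversal of the second place involution on `𝓗`** (`m = 2`, the two involutions differ everywhere). [folklore] -/
theorem transversal_pair (hm : m = 2) {s s' : G} (hs : s ∈ T₀.1 \ T₁.1) (hs' : s' ∈ T₀.1) (hss' : s' = s * Q ∨ s' = c * (s * Q)) :
    ({s, s'} : Finset G) ⊆ T₀.1 \ T₁.1 ∧ ({s, s'} : Finset G).card = m ∧
      ∀ v ∈ T₀.1 \ T₁.1, ∀ v'' ∈ T₀.1, (v'' = v * Q₂ ∨ v'' = c * (v * Q₂)) → (v ∈ ({s, s'} : Finset G) ↔ v'' ∉ ({s, s'} : Finset G)) := by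
  have hHc : (T₀.1 ∩ T₁.1).Nonempty := by
    apply card_pos.mp; have h0 := card_sdiff_add_card_inter T₀.1 T₁.1; omega
  have hs0 : s ∈ T₀.1 := (mem_sdiff.mp hs).1
  have hs'H : s' ∈ T₀.1 \ T₁.1 := (hσH s hs0 s' hs' hss').mp hs
  have hss'ne : s ≠ s' := ne_rep c hc2 T₀ T₁ m hH Q hQ hcen (by omega) hHc hss'
  have hback : s = s' * Q ∨ s = c * (s' * Q) := rep_rep c hc2 hQQ hss'
  refine ⟨?_, by rw [card_pair hss'ne, hm], fun v hv v'' hv''0 hvv'' => ?_⟩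
  · intro x hx; rw [mem_insert, mem_singleton] at hx; rcases hx with rfl | rfl
    · exact hs
    · exact hs'H
  have hv0 : v ∈ T₀.1 := (mem_sdiff.mp hv).1
  have hv''H : v'' ∈ T₀.1 \ T₁.1 := (hσH₂ v hv0 v'' hv''0 hvv'').mp hv
  have hvne : v ≠ v'' := ne_rep c hc2 T₀ T₁ m hH Q₂ hQ₂ hcen (by omega) hHc hvv''
  constructor
  · intro hvss' hv''ss'
    rw [mem_insert, mem_singleton] at hvss' hv''ss'
    rcases hvss' with rfl | rfl <;> rcases hv''ss' with h | h
    · exact hvne h.symm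
    · exact hne _ hv0 _ hs' _ hv''0 hss' hvv'' h.symm
    · exact hne _ hv0 _ hs0 _ hv''0 hback hvv'' h.symm
    · exact hvne h.symm
  · intro hv''ss'
    by_contra hvss'
    -- `v, σv, v'' = σ₂v` and `s, s'` would be five distinct elements of the four-element `𝓗`
    obtain ⟨p, hp0, hvp⟩ := exists_rep c T₀.2 (v * Q)
    have hpH : p ∈ T₀.1 \ T₁.1 := (hσH v hv0 p hp0 hvp).mp hv
    have hpss' : p ∉ ({s, s'} : Finset G) := fun h => hvss' ((pair_stable c hc2 T₀.2 hQQ hs0 hs' hss' hv0 hp0 hvp).mpr h)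
    have hvp' : v ≠ p := ne_rep c hc2 T₀ T₁ m hH Q hQ hcen (by omega) hHc hvp
    have hv''p : p ≠ v'' := hne v hv0 p hp0 v'' hv''0 hvp hvv''
    have h5 : ({v'', v, p, s, s'} : Finset G).card = 5 := by
      rw [card_insert_of_notMem, card_insert_of_notMem, card_insert_of_notMem hpss', card_pair hss'ne]
      · rw [mem_insert]; rintro (h | h)
        · exact hvp' h
        · exact hvss' h
      · rw [mem_insert, mem_insert]; rintro (h | h | h)
        · exact hvne h.symm
        · exact hv''p h.symm
        · exact hv''ss' h
    have hsub : ({v'', v, p, s, s'} : Finset G) ⊆ T₀.1 \ T₁.1 := by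
      intro x hx; simp only [mem_insert, mem_singleton] at hx
      rcases hx with rfl | rfl | rfl | rfl | rfl
      · exact hv''H
      · exact hv
      · exact hpH
      · exact hs
      · exact hs'H
    have h := card_le_card hsub
    rw [h5, hH, hm] at h
    omega

include hc2 hcen hn hH hQ hQQ hσH hQ₂ hσH₂ hne in
/-- **A swapped pair `{a, σa} ⊆ T₀ ∩ T₁` is a transversal of the second place involution on `T₀ ∩ T₁`** (`m = 2`) — §1 in the companion frame. [folklore] -/
theorem transversal_pair_inter (hm : m = 2) {a a' : G} (ha : a ∈ T₀.1 ∩ T₁.1) (ha' : a' ∈ T₀.1) (haa' : a' = a * Q ∨ a' = c * (a * Q)) :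
    ({a, a'} : Finset G) ⊆ T₀.1 ∩ T₁.1 ∧ ({a, a'} : Finset G).card = m ∧
      ∀ v ∈ T₀.1 ∩ T₁.1, ∀ v'' ∈ T₀.1, (v'' = v * Q₂ ∨ v'' = c * (v * Q₂)) → (v ∈ ({a, a'} : Finset G) ↔ v'' ∉ ({a, a'} : Finset G)) := by
  have hHc : T₀.1 \ (rt c c T₁).1 = T₀.1 ∩ T₁.1 := sdiff_compl_eq_inter c hcen T₀ T₁
  have hne' : ∀ t ∈ T₀.1, ∀ t' ∈ T₀.1, ∀ t'' ∈ T₀.1, (t' = t * (c * Q) ∨ t' = c * (t * (c * Q))) →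
      (t'' = t * (c * Q₂) ∨ t'' = c * (t * (c * Q₂))) → t' ≠ t'' := by
    intro t ht t' ht' t'' ht'' h1 h2
    rw [or_companion_iff c hc2 hcen] at h1 h2
    exact hne t ht t' ht' t'' ht'' h1 h2
  have h := transversal_pair c hc2 hcen T₀ (rt c c T₁) m hn (companion_card c hcen T₀ T₁ m hn hH) (c * Q) (companion_rt c T₀ T₁ Q hQ)
    (companion_sq c hc2 hcen Q hQQ) (companion_swap c hc2 hcen T₀ T₁ Q hσH) (c * Q₂) (companion_rt c T₀ T₁ Q₂ hQ₂)
    (companion_swap c hc2 hcen T₀ T₁ Q₂ hσH₂) hne' hm (by rw [hHc]; exact ha) ha' ((or_companion_iff c hc2 hcen Q a a').mpr haa')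
  rw [hHc] at h
  obtain ⟨h1, h2, h3⟩ := h
  exact ⟨h1, h2, fun v hv v'' hv'' hvv'' => h3 v hv v'' hv'' ((or_companion_iff c hc2 hcen Q₂ v v'').mpr hvv'')⟩

/-! ## §2 All `Y_s` are congruent modulo `L` -/

include hc2 hcen hbase hn hH hQ hQQ hσH hQ₂ hQQ₂ hσH₂ hne hLrt hcover in
/-- **ALL `Y_s` (`s ∈ 𝓗`) ARE CONGRUENT MODULO `L`** (`m = 2`, two swaps): `(f_{s₁} + g_{s₁}) − (f_{s₂} + g_{s₂}) ∈ L` for all `s₁, s₂ ∈ 𝓗`. [folklore] -/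
theorem Y_sub_Y_mem_of_swaps (hm : m = 2) (T : Finset G) (hTH : T ⊆ T₀.1 \ T₁.1) (hTm : T.card = m)
    (hT : ∀ t ∈ T₀.1 \ T₁.1, ∀ t' ∈ T₀.1, (t' = t * Q ∨ t' = c * (t * Q)) → (t ∈ T ↔ t' ∉ T)) :
    ∀ s₁ ∈ T₀.1 \ T₁.1, ∀ s₂ ∈ T₀.1 \ T₁.1,
      (Finsupp.single (oflipCM c hc2 s₁ T₀) (1 : ℤ) + Finsupp.single (oflipCM c hc2 s₁ T₁) 1) -
        (Finsupp.single (oflipCM c hc2 s₂ T₀) (1 : ℤ) + Finsupp.single (oflipCM c hc2 s₂ T₁) 1) ∈ L := by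
  have hm2 : 2 ≤ m := by omega
  have hHc : (T₀.1 ∩ T₁.1).Nonempty := by
    apply card_pos.mp; have h0 := card_sdiff_add_card_inter T₀.1 T₁.1; omega
  -- one step along `σ`
  have hσ : ∀ s ∈ T₀.1 \ T₁.1, ∀ s' ∈ T₀.1, (s' = s * Q ∨ s' = c * (s * Q)) →
      (Finsupp.single (oflipCM c hc2 s T₀) (1 : ℤ) + Finsupp.single (oflipCM c hc2 s T₁) 1) -
        (Finsupp.single (oflipCM c hc2 s' T₀) (1 : ℤ) + Finsupp.single (oflipCM c hc2 s' T₁) 1) ∈ L := by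
    intro s hs s' hs'0 hss'
    by_cases hsT : s ∈ T
    · exact Y_sub_Y_mem c hc2 hcen T₀ T₁ hbase m hn hH Q hQ hQQ hσH L hLrt hcover hm2 T hTH hTm hT hsT hs'0 hss'
    · have hs'T : s' ∈ T := by
        by_contra h; exact hsT ((hT s hs s' hs'0 hss').mpr h)
      have hback : s = s' * Q ∨ s = c * (s' * Q) := rep_rep c hc2 hQQ hss'
      have h := Y_sub_Y_mem c hc2 hcen T₀ T₁ hbase m hn hH Q hQ hQQ hσH L hLrt hcover hm2 T hTH hTm hT hs'T (mem_sdiff.mp hs).1 hback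
      have h' := Submodule.neg_mem _ h
      rwa [neg_sub] at h'
  -- one step along `σ₂`: the `σ`-pair through `s` is a `σ₂`-transversal
  have hσ₂ : ∀ s ∈ T₀.1 \ T₁.1, ∀ s'' ∈ T₀.1, (s'' = s * Q₂ ∨ s'' = c * (s * Q₂)) →
      (Finsupp.single (oflipCM c hc2 s T₀) (1 : ℤ) + Finsupp.single (oflipCM c hc2 s T₁) 1) -
        (Finsupp.single (oflipCM c hc2 s'' T₀) (1 : ℤ) + Finsupp.single (oflipCM c hc2 s'' T₁) 1) ∈ L := by
    intro s hs s'' hs''0 hss''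
    obtain ⟨s', hs'0, hss'⟩ := exists_rep c T₀.2 (s * Q)
    obtain ⟨hsub, hcard, htr⟩ := transversal_pair c hc2 hcen T₀ T₁ m hn hH Q hQ hQQ hσH Q₂ hQ₂ hσH₂ hne hm hs hs'0 hss'
    exact Y_sub_Y_mem c hc2 hcen T₀ T₁ hbase m hn hH Q₂ hQ₂ hQQ₂ hσH₂ L hLrt hcover hm2 {s, s'} hsub hcard htr (mem_insert_self _ _) hs''0 hss''
  -- `𝓗 = {s₁, σs₁, σ₂s₁, σσ₂s₁}`
  intro s₁ hs₁ s₂ hs₂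
  have hs₁0 : s₁ ∈ T₀.1 := (mem_sdiff.mp hs₁).1
  obtain ⟨p, hp0, hp⟩ := exists_rep c T₀.2 (s₁ * Q)
  obtain ⟨r, hr0, hr⟩ := exists_rep c T₀.2 (s₁ * Q₂)
  obtain ⟨u, hu0, hu⟩ := exists_rep c T₀.2 (r * Q)
  have hpH : p ∈ T₀.1 \ T₁.1 := (hσH s₁ hs₁0 p hp0 hp).mp hs₁
  have hrH : r ∈ T₀.1 \ T₁.1 := (hσH₂ s₁ hs₁0 r hr0 hr).mp hs₁
  have huH : u ∈ T₀.1 \ T₁.1 := (hσH r hr0 u hu0 hu).mp hrH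
  have h1p : s₁ ≠ p := ne_rep c hc2 T₀ T₁ m hH Q hQ hcen (by omega) hHc hp
  have h1r : s₁ ≠ r := ne_rep c hc2 T₀ T₁ m hH Q₂ hQ₂ hcen (by omega) hHc hr
  have hpr : p ≠ r := hne s₁ hs₁0 p hp0 r hr0 hp hr
  have hru : r ≠ u := ne_rep c hc2 T₀ T₁ m hH Q hQ hcen (by omega) hHc hu
  have h1u : s₁ ≠ u := by
    rintro rfl
    exact hpr (rep_unique' c T₀.2 hp0 hr0 hp (rep_rep c hc2 hQQ hu))
  have hpu : p ≠ u := by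
    rintro rfl
    exact h1r (rep_unique' c T₀.2 hs₁0 hr0 (rep_rep c hc2 hQQ hp) (rep_rep c hc2 hQQ hu))
  have h4 : ({s₁, p, r, u} : Finset G).card = 4 := by
    rw [card_insert_of_notMem, card_insert_of_notMem, card_pair hru]
    · rw [mem_insert, mem_singleton]; rintro (h | h)
      · exact hpr h
      · exact hpu h
    · rw [mem_insert, mem_insert, mem_singleton]; rintro (h | h | h)
      · exact h1p h
      · exact h1r h
      · exact h1u h
  have hsub : ({s₁, p, r, u} : Finset G) ⊆ T₀.1 \ T₁.1 := by
    intro x hx; simp only [mem_insert, mem_singleton] at hx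
    rcases hx with rfl | rfl | rfl | rfl
    · exact hs₁
    · exact hpH
    · exact hrH
    · exact huH
  have heq : ({s₁, p, r, u} : Finset G) = T₀.1 \ T₁.1 := eq_of_subset_of_card_le hsub (by rw [h4, hH, hm])
  have hs₂' : s₂ ∈ ({s₁, p, r, u} : Finset G) := by rw [heq]; exact hs₂
  simp only [mem_insert, mem_singleton] at hs₂'
  rcases hs₂' with rfl | rfl | rfl | rfl
  · rw [sub_self]; exact Submodule.zero_mem _
  · exact hσ s₁ hs₁ _ hp0 hp
  · exact hσ₂ s₁ hs₁ _ hr0 hr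
  · have h := Submodule.add_mem _ (hσ₂ s₁ hs₁ r hr0 hr) (hσ r hrH _ hu0 hu)
    rwa [sub_add_sub_cancel] at h

include hc2 hcen hbase hn hH hQ hQQ hσH hQ₂ hQQ₂ hσH₂ hne hLrt hcover in
/-- **`2Y_s ∈ L` for every `s ∈ 𝓗`** from ONE sum `Y_{s₀} + Y_{s₀'} ∈ L` (`m = 2`, two swaps). [folklore] -/
theorem two_smul_Y_mem_of_swaps (hm : m = 2) (T : Finset G) (hTH : T ⊆ T₀.1 \ T₁.1) (hTm : T.card = m)
    (hT : ∀ t ∈ T₀.1 \ T₁.1, ∀ t' ∈ T₀.1, (t' = t * Q ∨ t' = c * (t * Q)) → (t ∈ T ↔ t' ∉ T))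
    (hsum : ∃ s₀ ∈ T₀.1 \ T₁.1, ∃ s₀' ∈ T₀.1 \ T₁.1,
      ((Finsupp.single (oflipCM c hc2 s₀ T₀) (1 : ℤ) - Finsupp.single T₀ 1) + (Finsupp.single (oflipCM c hc2 s₀ T₁) (1 : ℤ) - Finsupp.single T₁ 1)) +
        ((Finsupp.single (oflipCM c hc2 s₀' T₀) (1 : ℤ) - Finsupp.single T₀ 1) + (Finsupp.single (oflipCM c hc2 s₀' T₁) (1 : ℤ) - Finsupp.single T₁ 1))
        ∈ L) :
    ∀ s ∈ T₀.1 \ T₁.1, (2 : ℤ) • ((Finsupp.single (oflipCM c hc2 s T₀) (1 : ℤ) - Finsupp.single T₀ 1) +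
      (Finsupp.single (oflipCM c hc2 s T₁) (1 : ℤ) - Finsupp.single T₁ 1)) ∈ L := by
  obtain ⟨s₀, hs₀, s₀', hs₀', hS⟩ := hsum
  have hall := Y_sub_Y_mem_of_swaps c hc2 hcen T₀ T₁ hbase m hn hH Q hQ hQQ hσH Q₂ hQ₂ hQQ₂ hσH₂ hne L hLrt hcover hm T hTH hTm hT
  intro s hs
  have h := Submodule.add_mem _ (Submodule.add_mem _ (hall s hs s₀ hs₀) (hall s hs s₀' hs₀')) hS
  have e : (2 : ℤ) • ((Finsupp.single (oflipCM c hc2 s T₀) (1 : ℤ) - Finsupp.single T₀ 1) +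
      (Finsupp.single (oflipCM c hc2 s T₁) (1 : ℤ) - Finsupp.single T₁ 1)) =
      (Finsupp.single (oflipCM c hc2 s T₀) (1 : ℤ) + Finsupp.single (oflipCM c hc2 s T₁) 1) -
        (Finsupp.single (oflipCM c hc2 s₀ T₀) (1 : ℤ) + Finsupp.single (oflipCM c hc2 s₀ T₁) 1) +
      ((Finsupp.single (oflipCM c hc2 s T₀) (1 : ℤ) + Finsupp.single (oflipCM c hc2 s T₁) 1) -
        (Finsupp.single (oflipCM c hc2 s₀' T₀) (1 : ℤ) + Finsupp.single (oflipCM c hc2 s₀' T₁) 1)) +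
      (((Finsupp.single (oflipCM c hc2 s₀ T₀) (1 : ℤ) - Finsupp.single T₀ 1) + (Finsupp.single (oflipCM c hc2 s₀ T₁) (1 : ℤ) - Finsupp.single T₁ 1)) +
        ((Finsupp.single (oflipCM c hc2 s₀' T₀) (1 : ℤ) - Finsupp.single T₀ 1) + (Finsupp.single (oflipCM c hc2 s₀' T₁) (1 : ℤ) - Finsupp.single T₁ 1)))
      := by module
  rw [e]; exact h

/-! ## §3 All `Y'_a` are congruent modulo `L` (companion frame) -/

include hc2 hcen hbase hn hH hQ hQQ hσH hQ₂ hQQ₂ hσH₂ hne hLrt hP hcover in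
/-- **`2Y'_a ∈ L` for every `a ∈ T₀ ∩ T₁`** from ONE sum `Y'_{a₀} + Y'_{a₀'} ∈ L` (`m = 2`, two swaps, pairs in `L`) — §2 in the companion frame. [folklore] -/
theorem two_smul_Y'_mem_of_swaps (hm : m = 2) (T' : Finset G) (hTH' : T' ⊆ T₀.1 ∩ T₁.1) (hTm' : T'.card = m)
    (hT' : ∀ t ∈ T₀.1 ∩ T₁.1, ∀ t' ∈ T₀.1, (t' = t * Q ∨ t' = c * (t * Q)) → (t ∈ T' ↔ t' ∉ T'))
    (hsum : ∃ a₀ ∈ T₀.1 ∩ T₁.1, ∃ a₀' ∈ T₀.1 ∩ T₁.1,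
      ((Finsupp.single (oflipCM c hc2 a₀ T₀) (1 : ℤ) - Finsupp.single T₀ 1) - (Finsupp.single (oflipCM c hc2 a₀ T₁) (1 : ℤ) - Finsupp.single T₁ 1)) +
        ((Finsupp.single (oflipCM c hc2 a₀' T₀) (1 : ℤ) - Finsupp.single T₀ 1) - (Finsupp.single (oflipCM c hc2 a₀' T₁) (1 : ℤ) - Finsupp.single T₁ 1))
        ∈ L) :
    ∀ a ∈ T₀.1 ∩ T₁.1, (2 : ℤ) • ((Finsupp.single (oflipCM c hc2 a T₀) (1 : ℤ) - Finsupp.single T₀ 1) -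
      (Finsupp.single (oflipCM c hc2 a T₁) (1 : ℤ) - Finsupp.single T₁ 1)) ∈ L := by
  have hHc : T₀.1 \ (rt c c T₁).1 = T₀.1 ∩ T₁.1 := sdiff_compl_eq_inter c hcen T₀ T₁
  have hne' : ∀ t ∈ T₀.1, ∀ t' ∈ T₀.1, ∀ t'' ∈ T₀.1, (t' = t * (c * Q) ∨ t' = c * (t * (c * Q))) →
      (t'' = t * (c * Q₂) ∨ t'' = c * (t * (c * Q₂))) → t' ≠ t'' := by
    intro t ht t' ht' t'' ht'' h1 h2
    rw [or_companion_iff c hc2 hcen] at h1 h2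
    exact hne t ht t' ht' t'' ht'' h1 h2
  have hT2 : ∀ t ∈ T₀.1 \ (rt c c T₁).1, ∀ t' ∈ T₀.1, (t' = t * (c * Q) ∨ t' = c * (t * (c * Q))) → (t ∈ T' ↔ t' ∉ T') := by
    intro t ht t' ht' h
    rw [or_companion_iff c hc2 hcen Q] at h
    rw [hHc] at ht
    exact hT' t ht t' ht' h
  have hsr : ∀ X : CMF G c, Finsupp.single (rt c c X) (1 : ℤ) = pair c X - Finsupp.single X 1 := fun X => by
    rw [pair, add_sub_cancel_left]
  -- the sum, transported to the companion frame
  obtain ⟨a₀, ha₀, a₀', ha₀', hS⟩ := hsum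
  have hS' : ((Finsupp.single (oflipCM c hc2 a₀ T₀) (1 : ℤ) - Finsupp.single T₀ 1) +
        (Finsupp.single (oflipCM c hc2 a₀ (rt c c T₁)) (1 : ℤ) - Finsupp.single (rt c c T₁) 1)) +
      ((Finsupp.single (oflipCM c hc2 a₀' T₀) (1 : ℤ) - Finsupp.single T₀ 1) +
        (Finsupp.single (oflipCM c hc2 a₀' (rt c c T₁)) (1 : ℤ) - Finsupp.single (rt c c T₁) 1)) ∈ L := by
    simp only [oflipCM_rt_self c hc2 hcen, hsr]
    have hp : pair c (oflipCM c hc2 a₀ T₁) + pair c (oflipCM c hc2 a₀' T₁) - (2 : ℤ) • pair c T₁ ∈ L :=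
      Submodule.sub_mem _ (Submodule.add_mem _ (hP _) (hP _)) (Submodule.smul_mem _ _ (hP _))
    have e : ((Finsupp.single (oflipCM c hc2 a₀ T₀) (1 : ℤ) - Finsupp.single T₀ 1) +
          ((pair c (oflipCM c hc2 a₀ T₁) - Finsupp.single (oflipCM c hc2 a₀ T₁) 1) - (pair c T₁ - Finsupp.single T₁ 1))) +
        ((Finsupp.single (oflipCM c hc2 a₀' T₀) (1 : ℤ) - Finsupp.single T₀ 1) +
          ((pair c (oflipCM c hc2 a₀' T₁) - Finsupp.single (oflipCM c hc2 a₀' T₁) 1) - (pair c T₁ - Finsupp.single T₁ 1))) =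
        (((Finsupp.single (oflipCM c hc2 a₀ T₀) (1 : ℤ) - Finsupp.single T₀ 1) - (Finsupp.single (oflipCM c hc2 a₀ T₁) (1 : ℤ) - Finsupp.single T₁ 1)) +
          ((Finsupp.single (oflipCM c hc2 a₀' T₀) (1 : ℤ) - Finsupp.single T₀ 1) -
            (Finsupp.single (oflipCM c hc2 a₀' T₁) (1 : ℤ) - Finsupp.single T₁ 1))) +
        (pair c (oflipCM c hc2 a₀ T₁) + pair c (oflipCM c hc2 a₀' T₁) - (2 : ℤ) • pair c T₁) := by module
    rw [e]; exact Submodule.add_mem _ hS hp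
  have h := two_smul_Y_mem_of_swaps c hc2 hcen T₀ (rt c c T₁) (companion_base c hc2 T₀ T₁ hbase) m hn (companion_card c hcen T₀ T₁ m hn hH)
    (c * Q) (companion_rt c T₀ T₁ Q hQ) (companion_sq c hc2 hcen Q hQQ) (companion_swap c hc2 hcen T₀ T₁ Q hσH) (c * Q₂)
    (companion_rt c T₀ T₁ Q₂ hQ₂) (companion_sq c hc2 hcen Q₂ hQQ₂) (companion_swap c hc2 hcen T₀ T₁ Q₂ hσH₂) hne' L hLrt hcover hm T'
    (by rw [hHc]; exact hTH') hTm' hT2 ⟨a₀, by rw [hHc]; exact ha₀, a₀', by rw [hHc]; exact ha₀', hS'⟩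
  intro a ha
  have ha' := h a (by rw [hHc]; exact ha)
  simp only [oflipCM_rt_self c hc2 hcen, hsr] at ha'
  have hp : (2 : ℤ) • (pair c (oflipCM c hc2 a T₁) - pair c T₁) ∈ L := Submodule.smul_mem _ _ (Submodule.sub_mem _ (hP _) (hP _))
  have e : (2 : ℤ) • ((Finsupp.single (oflipCM c hc2 a T₀) (1 : ℤ) - Finsupp.single T₀ 1) -
      (Finsupp.single (oflipCM c hc2 a T₁) (1 : ℤ) - Finsupp.single T₁ 1)) =
      (2 : ℤ) • ((Finsupp.single (oflipCM c hc2 a T₀) (1 : ℤ) - Finsupp.single T₀ 1) +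
        ((pair c (oflipCM c hc2 a T₁) - Finsupp.single (oflipCM c hc2 a T₁) 1) - (pair c T₁ - Finsupp.single T₁ 1))) -
      (2 : ℤ) • (pair c (oflipCM c hc2 a T₁) - pair c T₁) := by module
  rw [e]; exact Submodule.sub_mem _ ha' hp

/-! ## §4 The residual closure from the two sums -/

include hc2 hcen hbase hn hH hQ hQQ hσH hQ₂ hQQ₂ hσH₂ hne hLrt hP hcover in
/-- **RESIDUAL CLOSURE AT `m = 2` FROM TWO SWAPS AND TWO SUMS.**  In the frame with the two swaps, a strict lowering cover feeding `L ∋ pairs`, transversals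
`T ⊆ 𝓗`, `T' ⊆ T₀ ∩ T₁` of `σ`, one sum `Y_{s₀} + Y_{s₀'} ∈ L` (`s₀, s₀' ∈ 𝓗`) and one sum `Y'_{a₀} + Y'_{a₀'} ∈ L` (`a₀, a₀' ∈ T₀ ∩ T₁`): every Hodge
vector supported on the residual types of `T₀` lies in `L` up to `2`. [folklore] -/
theorem residual_closure_frame_two (hc1 : c ≠ 1) (hm : m = 2) (T : Finset G) (hTH : T ⊆ T₀.1 \ T₁.1) (hTm : T.card = m)
    (hT : ∀ t ∈ T₀.1 \ T₁.1, ∀ t' ∈ T₀.1, (t' = t * Q ∨ t' = c * (t * Q)) → (t ∈ T ↔ t' ∉ T))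
    (T' : Finset G) (hTH' : T' ⊆ T₀.1 ∩ T₁.1) (hTm' : T'.card = m)
    (hT' : ∀ t ∈ T₀.1 ∩ T₁.1, ∀ t' ∈ T₀.1, (t' = t * Q ∨ t' = c * (t * Q)) → (t ∈ T' ↔ t' ∉ T'))
    (hsum : ∃ s₀ ∈ T₀.1 \ T₁.1, ∃ s₀' ∈ T₀.1 \ T₁.1,
      ((Finsupp.single (oflipCM c hc2 s₀ T₀) (1 : ℤ) - Finsupp.single T₀ 1) + (Finsupp.single (oflipCM c hc2 s₀ T₁) (1 : ℤ) - Finsupp.single T₁ 1)) +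
        ((Finsupp.single (oflipCM c hc2 s₀' T₀) (1 : ℤ) - Finsupp.single T₀ 1) + (Finsupp.single (oflipCM c hc2 s₀' T₁) (1 : ℤ) - Finsupp.single T₁ 1))
        ∈ L)
    (hsum' : ∃ a₀ ∈ T₀.1 ∩ T₁.1, ∃ a₀' ∈ T₀.1 ∩ T₁.1,
      ((Finsupp.single (oflipCM c hc2 a₀ T₀) (1 : ℤ) - Finsupp.single T₀ 1) - (Finsupp.single (oflipCM c hc2 a₀ T₁) (1 : ℤ) - Finsupp.single T₁ 1)) +
        ((Finsupp.single (oflipCM c hc2 a₀' T₀) (1 : ℤ) - Finsupp.single T₀ 1) - (Finsupp.single (oflipCM c hc2 a₀' T₁) (1 : ℤ) - Finsupp.single T₁ 1))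
        ∈ L) :
    ∀ y ∈ hodgeSpan c hc2, (∀ Ψ ∈ y.support, bpot c T₀ Ψ ≤ 1) → ((2 : ℤ) ^ 1) • y ∈ L := by
  have hm2 : 2 ≤ m := by omega
  have hHc : (T₀.1 ∩ T₁.1).card = 2 * m := by
    have h0 := card_sdiff_add_card_inter T₀.1 T₁.1; omega
  have hclose := residual_closure_four c hc2 hc1 hcen T₀ T₁ L hP m hH hHc
    (two_smul_Y_mem_of_swaps c hc2 hcen T₀ T₁ hbase m hn hH Q hQ hQQ hσH Q₂ hQ₂ hQQ₂ hσH₂ hne L hLrt hcover hm T hTH hTm hT hsum)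
    (two_smul_Y'_mem_of_swaps c hc2 hcen T₀ T₁ hbase m hn hH Q hQ hQQ hσH Q₂ hQ₂ hQQ₂ hσH₂ hne L hLrt hP hcover hm T' hTH' hTm' hT' hsum')
    ⟨T, hTH, hTm, rel_transversal_mem c hc2 hcen T₀ T₁ hbase m hn hH Q hQ hQQ hσH L hLrt hcover hm2 T hTH hTm hT⟩
    ⟨T', hTH', hTm', relc_mem c hc2 hcen T₀ T₁ hbase m hn hH Q hQ hQQ hσH L hLrt hcover hP hm2 T' hTH' hTm' hT'⟩
  intro y hy hyR
  refine hclose y hy fun Ψ hΨ => ?_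
  rcases residual_cases c T₀ hc2 (hyR Ψ hΨ) with ⟨Q', rfl⟩ | ⟨Q', s, -, rfl⟩
  · rcases hbase Q' with h | h | h | h
    · exact Or.inl h
    · exact Or.inr (Or.inr (Or.inl h))
    · exact Or.inr (Or.inl h)
    · exact Or.inr (Or.inr (Or.inr (Or.inl h)))
  · right; right; right; right
    refine ⟨s * Q'⁻¹, ?_⟩
    rw [rt_oflipCM]
    rcases hbase Q' with h | h | h | h <;> rw [h]
    · exact Or.inl rfl
    · exact Or.inr (Or.inr (Or.inl rfl))
    · exact Or.inr (Or.inl rfl)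
    · exact Or.inr (Or.inr (Or.inr rfl))

end Frame

end

end Summit.HodgeConjecture.CorCM.Census.CentralSquares
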